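import Summits.QuantumFields.BalabanUV.T4Continuum.Support.SubstrateProbesChartLev
import Summits.QuantumFields.BalabanUV.T4Continuum.Support.SubstrateTransporterSpeciesLevExplicit

/-!
# SUBSTRATE — JUNCTION AT LEVEL LETTERS, EXPLICIT RADIUS (typer NEXT gen 7.1 W-2, the two pencilled probe names; LIBRARY L-A5′ ∕ L-E5):
# NE4 L3's `hAan : A ∈ Pr.Analytic α` for the species-entry families at the PRINTED letters with the EXPLICIT `α := rhoLev` of
# `SubstrateTransporterSpeciesLevExplicit` (p3's form-relative `rhoStar(γ, d, a′, |o|)` over the top level) — one radius for all `(k, p)`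

Cell `pub-balaban`, SUBSTRATE cell, seat `b2b-balaban-substrate-p1` (gen 3).  Summits-side under the LEAN PLACEMENT RULE.  A separate junction
(as p222415 ∕ p223525) so that the species modules' cones stay free of the read-out Literature chain and the probe modules' cones acquire p3's
form-relative count only here.  BOOKKEEPING ONLY: `tagSlice_mem_analytic_cubeProbesC_of_ball` (p223525) + `analyticOnNhd_covAtTLev_printed_on_ballExplicit`
∕ `…_towerDataOf_explicit` (p223952).  HONEST FRAMING: rung (B)+1 of the FINITE-VOLUME T⁴ programme — NOT infinite volume, NOT a mass gap, NOT Clay;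
spine PROVED 0∕9; NE4 NOT proved; which term family NE4's functional of record reads, which background per run and how `α` is read per level
(`rhoLev_le_div`) are the NE4 owner's; nothing printed is asserted ([Balaban1987RG1] (1.17)–(1.22) KIND only).  HONEST DEPENDENCY (cell line,
verbatim): continuum YM on T⁴ ⇐ BetaPertH ∧ nine spine estimates (0/9 proved); BetaPertH ⇐ (D1) ∧ (D4) ∧ CAP+tail; G-an2-4 gates asym, D1
and NE2/3/4.
-/

noncomputable section

open scoped BigOperators Matrix Matrix.Norms.L2Operator

namespace Summit.QuantumFields.BalabanUV.T4Continuum.SubstrateProbesChartLevExplicit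

open Literature.MathematicalPhysics.QuantumFieldTheory.Balaban1983to89
open Literature.MathematicalPhysics.QuantumFieldTheory.Balaban1983to89.B5Prop11Plancherel (Tor fine)
open Literature.MathematicalPhysics.QuantumFieldTheory.Balaban1983to89.B5G183RateUnitTower (lev)
open Literature.MathematicalPhysics.QuantumFieldTheory.Balaban1983to89.T4BetaReadOutLipschitz (Probes tagSlice)
open Summit.QuantumFields.BalabanUV.T4Continuum.CovariantBlockAveraging (ContourSystem transport)
open Summit.QuantumFields.BalabanUV.T4Continuum.CoerciveInverseTower (Coercive)
open Summit.QuantumFields.BalabanUV.T4Continuum.CovariantVectorCoercive (vecOp gammaV)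
open Summit.QuantumFields.BalabanUV.T4Continuum.B13Carriers (TwoRuns)
open Summit.QuantumFields.BalabanUV.T4Continuum.SubstrateBackgroundTransporters (unitMod)
open Summit.QuantumFields.BalabanUV.T4Continuum.SubstrateTransporterSpecies (TowerData towerDataOf)
open Summit.QuantumFields.BalabanUV.T4Continuum.SubstrateTransporterSpeciesLev (cPr aPr)
open Summit.QuantumFields.BalabanUV.T4Continuum.SubstrateTransporterSpeciesLevExplicit (rhoLev analyticOnNhd_covAtTLev_printed_on_ballExplicit
  analyticOnNhd_covAtTLev_printed_towerDataOf_explicit)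
open Summit.QuantumFields.BalabanUV.T4Continuum.SubstrateProbesOfRecord (cubeProbesC)
open Summit.QuantumFields.BalabanUV.T4Continuum.SubstrateProbesChartLev (covEntryFamilyLev tagSlice_mem_analytic_cubeProbesC_of_ball)

variable {G : Type} [GaugeGroup G] (R : TwoRuns G) (P : Params) {o : Type} [Fintype o] [DecidableEq o] [Nonempty o]
variable {dirA dirB : ℕ → R.carriers.Dom → TowerData P o} {wt : ℕ → R.carriers.Dom → ℝ}
variable (Γ : (k : ℕ) → ContourSystem P.d (lev P.L k) (unitMod P)) (s : ℕ → ℂ) {T : Type} (kOf : R.carriers.Dom → ℕ) (tOf : R.carriers.Dom → T)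
  (bOf b'Of : R.carriers.Dom → (Tor (unitMod P) × Fin P.d) × o)

variable {R₀ : TowerData P o} (hR₀ : ∀ (k : Fin (P.K + 1)) ν i, R₀ k ν i ∈ Matrix.unitaryGroup o ℂ) {a' γ : ℝ} (ha' : 0 ≤ a')
  (hco : ∀ k : Fin (P.K + 1), Coercive γ (vecOp (lev P.L k) (unitMod P) a' (Γ k) (R₀ k))) (hγ : 0 < γ)
  {ℓ : Fin (P.K + 1) → ℕ} (hΓ : ∀ (k : Fin (P.K + 1)) y j μ (t : Fin (lev P.L k)), (Γ k y j μ t).length ≤ ℓ k)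
  (hℓ : ∀ k : Fin (P.K + 1), (ℓ k : ℝ) ≤ ((P.d : ℝ) + 1) * (lev P.L k : ℕ))

include hR₀ ha' hco hγ hΓ hℓ in
/-- [folklore] **NE4 L3's `hAan` WITH THE EXPLICIT RADIUS**: at the printed letters, for a unitary reference tower, levelwise `γ`-coercive with ONE
level-free `γ`, `0 ≤ a′`, contour lengths `ℓ_k ≤ (d+1)·lev k`, the tagged slice of every level-lettered species-entry family lies in
`(cubeProbesC …).Analytic (rhoLev P γ a′)` — `rhoLev = rhoStar(γ, d, a′, |o|) ∕ L^K` EXPLICIT, one radius for all steps and probes. -/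
theorem covEntryFamilyLev_mem_analytic_rhoLev :
    tagSlice (covEntryFamilyLev R P (cPr P) (aPr P a') Γ R₀ s kOf tOf bOf b'Of) ∈ (cubeProbesC R dirA dirB wt).Analytic (rhoLev P (o := o) γ a') :=
  tagSlice_mem_analytic_cubeProbesC_of_ball R P _ fun p =>
    analyticOnNhd_covAtTLev_printed_on_ballExplicit P Γ hR₀ ha' hco hγ hΓ hℓ s (kOf p) (tOf p) (bOf p) (b'Of p)

section Record

variable {G' : Type*} [GaugeGroup G'] (ι : G' →* Matrix o o ℂ) (av : ∀ j, Averaging P j G') {α τ : ℝ}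
variable (hι : ∀ g, ι g ∈ Matrix.unitaryGroup o ℂ) (hdist : ∀ g : G', ‖ι g - 1‖ = dist1 g) (U : GaugeField P 0 G') (ha'0 : 0 < a')
  (hα : 0 ≤ α) (hτ : 0 ≤ τ)
  (hU : ∀ (k : Fin (P.K + 1)) (b : PBond P (P.K - k)), ((lev P.L k : ℕ) : ℝ) * dist1 (Averaging.iter av (P.K - k) U b) ≤ α)
  (hT : ∀ (k : Fin (P.K + 1)) y jj μ (t : Fin (lev P.L k)),
    ‖transport (fine (lev P.L k) (unitMod P)) (towerDataOf P ι av U k) μ (Γ k y jj μ t) - 1‖ ≤ τ)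
  (hγV : 0 < gammaV (Fintype.card o) P.d a' α τ)

include hι hdist ha'0 hα hτ hU hT hγV hΓ hℓ in
/-- [folklore] **… AT THE TOWER DATA OF RECORD** of a levelwise-regular `U` (unitary `ι`, `‖ι g − 1‖ = dist1 g`, small-field letters `α`, `τ` per
level, `0 < a′`, `0 < gammaV`, contour lengths): in `(cubeProbesC …).Analytic (rhoLev P (gammaV (card o) d a′ α τ) a′)` — radius BACKGROUND-FREE. -/
theorem covEntryFamilyLev_mem_analytic_rhoLev_towerDataOf :
    tagSlice (covEntryFamilyLev R P (cPr P) (aPr P a') Γ (towerDataOf P ι av U) s kOf tOf bOf b'Of)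
      ∈ (cubeProbesC R dirA dirB wt).Analytic (rhoLev P (o := o) (gammaV (Fintype.card o) P.d a' α τ) a') :=
  tagSlice_mem_analytic_cubeProbesC_of_ball R P _ fun p =>
    analyticOnNhd_covAtTLev_printed_towerDataOf_explicit P Γ hΓ hℓ s ι av hι hdist U ha'0 hα hτ hU hT hγV (kOf p) (tOf p) (bOf p) (b'Of p)

end Record

end Summit.QuantumFields.BalabanUV.T4Continuum.SubstrateProbesChartLevExplicit

end
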